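import Summits.HodgeConjecture.HodgeConjecture.Theorems.MarkmanPartnerTransportPicardThreeK3SquaresKugaSatakeSector
import Literature.AlgebraicGeometry.Surfaces.K3Marking
import Literature.AlgebraicGeometry.HodgeTheory.MixedEllipticCurvesProductsHodgeClasses

/-!
# Route MarkmanPartnerTransport · crux `PicardThreeK3Squares` (stmt-HodgeConjecture-19652) —
# the Kuga–Satake sector by name: `T(S)_ℚ ≅ U_ℚ² ⊕ ⟨a⟩ ⊕ ⟨b⟩` (Varesco's predicate) ⇒ HC for all powers and for `S ⊗ S`

Sequel to `Theorems/…KugaSatakeSector` (`hodgeConjectureFor_powers_of_transcendental_le_U2ab`: the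
explicit Floccari embedding `U_ℚ² ⊕ ⟨a⟩ ⊕ ⟨b⟩ ↪ U³ ⊕ ⟨b⟩` in marking coordinates). This file removes
the coordinates: it starts from the tree's sign-free predicate `HasTranscendentalLatticeU2ab S a b`
(`T(S) ⊗ ℚ ≅ U_ℚ² ⊕ ⟨a⟩ ⊕ ⟨b⟩`, the hypothesis on the general fibre in Varesco 2025 Thm. 0.2/4.3) and
a marking, and concludes

* `hodgeConjectureFor_powers_of_hasTranscendentalLatticeU2ab` — HC for every power `Sᵏ`,
* `hodgeConjectureFor_square_of_hasTranscendentalLatticeU2ab` — HC for `S ⊗ S` (the crux's shape),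

for EVERY projective K3 surface with `T(S)_ℚ ≅ U_ℚ² ⊕ ⟨a⟩ ⊕ ⟨b⟩`, `a, b < 0`, modulo the named facts
`Floccari2026_hodgeClasses_algebraic_powers_of_K3_of_transcendental_embedding` (Geom. Topol. 2026,
Thm. 5.11 (ii)) and `Huybrechts_K3_marking_exists` — i.e. Varesco's Thm. 0.2 without its family and
without its Kuga–Satake hypothesis. The bridge (`exists_coords_of_hasTranscendentalLatticeU2ab`) needs
two lattice facts proved here on the tree's `k3FormRat`: the `19`-dimensional negative definite
subspace over `ℚ` (`k3FormRat_self_neg_of_antidiag`, from the integral `k3Lattice_neg_of_antidiag`) and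
hence **no four pairwise orthogonal vectors of positive square in `Λ_ℚ`** (`not_four_orthogonal_pos`,
signature `(3,19)`), which pins the sign of the generator of `H⁴` in the predicate against the
marking's. Conversely (`exists_isotropic_pair_of_embedding`), a `6`-dimensional subspace of `Λ_ℚ`
with a Floccari embedding into `(U³ ⊕ ⟨-m⟩) ⊗ ℚ` contains a totally isotropic plane (Witt index
two), so at `ρ(S) = 16` Floccari's sector is exactly Varesco's lattices and the residue of the crux
there is the K3 surfaces whose `T(S)_ℚ` has Witt index one.

No definition, no sorry; named facts only as hypotheses. Prover seat hodge-nonav-19652-p1 (gen 2),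
`--supports stmt-HodgeConjecture-19652`.

References: Floccari, Geom. Topol. 30 (2026) Thm. 5.11; Varesco, Michigan Math. J. 75 (2025) Thm. 4.3; Huybrechts, K3 book, Ch. 1 Prop. 3.5, Ch. 14 §0.3.
-/

set_option linter.dupNamespace false

noncomputable section

namespace Summit.HodgeConjecture.HodgeConjecture.Theorems.MarkmanPartnerTransport.KugaSatakeSector

open CategoryTheory MonoidalCategory
open Literature.AlgebraicGeometry Literature.AlgebraicGeometry.Motives Literature.AlgebraicGeometry.HodgeTheory
open Literature.AlgebraicGeometry.Surfaces
open Literature.AlgebraicTopology.SingularHomology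

variable {S : SchemeOver ℂ}

/-! ### Signature bookkeeping in `Λ_ℚ`: no four pairwise orthogonal vectors of positive square -/

/-- **The rational K3 form is negative definite on the `19`-dimensional subspace
`E₈(−1)^{⊕2} ⊕ ⟨e₁ − f₁, e₂ − f₂, e₃ − f₃⟩ ⊗ ℚ`** (vectors whose coordinates on each hyperbolic pair
are opposite): the integral statement `k3Lattice_neg_of_antidiag` after clearing denominators
(`latticeMultiple`). [cite: Huybrechts2016K3, Ch. 14 §0.3 (vi) (signature `(3, 19)`)] -/
theorem k3FormRat_self_neg_of_antidiag {v : K3Index → ℚ}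
    (h1 : v (Sum.inr (Sum.inl 1)) = -v (Sum.inr (Sum.inl 0)))
    (h2 : v (Sum.inr (Sum.inr (Sum.inl 1))) = -v (Sum.inr (Sum.inr (Sum.inl 0))))
    (h3 : v (Sum.inr (Sum.inr (Sum.inr 1))) = -v (Sum.inr (Sum.inr (Sum.inr 0))))
    (hv0 : v ≠ 0) : k3FormRat v v < 0 := by
  have hD : (0 : ℚ) < ((∏ j, (v j).den : ℕ) : ℚ) :=
    lt_of_le_of_ne (Nat.cast_nonneg _) (prod_den_ne_zero v).symm
  have hw : ∀ i i' : K3Index, v i = -v i' → latticeMultiple v i = -latticeMultiple v i' := by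
    intro i i' h
    have hi := congrFun (intCast_latticeMultiple v) i
    have hi' := congrFun (intCast_latticeMultiple v) i'
    simp only [Pi.smul_apply, smul_eq_mul] at hi hi'
    have h' : (latticeMultiple v i : ℚ) = -(latticeMultiple v i' : ℚ) := by rw [hi, hi', h, mul_neg]
    exact_mod_cast h'
  have hw0 : latticeMultiple v ≠ 0 := by
    intro h0
    apply hv0
    funext i
    have h := congrFun (intCast_latticeMultiple v) i
    rw [h0] at h
    simp only [Pi.zero_apply, Int.cast_zero, Pi.smul_apply, smul_eq_mul] at h
    rcases mul_eq_zero.1 h.symm with h | h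
    · exact absurd h (prod_den_ne_zero v)
    · rw [h, Pi.zero_apply]
  have hneg := k3Lattice_neg_of_antidiag (v := latticeMultiple v) (hw _ _ h1) (hw _ _ h2) (hw _ _ h3) hw0
  have hsq : k3FormRat (fun i => (latticeMultiple v i : ℚ)) (fun i => (latticeMultiple v i : ℚ)) =
      ((∏ j, (v j).den : ℕ) : ℚ) * ((∏ j, (v j).den : ℕ) : ℚ) * k3FormRat v v := by
    rw [intCast_latticeMultiple]
    simp only [map_smul, LinearMap.smul_apply, smul_eq_mul]
    ring
  rw [k3FormRat_intCast] at hsq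
  have hlt : ((∏ j, (v j).den : ℕ) : ℚ) * ((∏ j, (v j).den : ℕ) : ℚ) * k3FormRat v v < 0 := by
    rw [← hsq]
    exact_mod_cast hneg
  nlinarith [mul_pos hD hD]

/-- **`Λ_ℚ` contains no four pairwise orthogonal vectors of positive square** (Sylvester: the
signature of `Λ_{K3}` is `(3, 19)`; here from the `19`-dimensional negative definite subspace of
`k3FormRat_self_neg_of_antidiag`: a positive definite subspace meets it trivially, so has dimension
`≤ 22 − 19 = 3`). [cite: Huybrechts2016K3, Ch. 14 §0.3 (vi) (signature `(3, 19)`)] -/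
theorem not_four_orthogonal_pos (u : Fin 4 → (K3Index → ℚ))
    (hpos : ∀ i, 0 < k3FormRat (u i) (u i)) (horth : ∀ i j, i ≠ j → k3FormRat (u i) (u j) = 0) :
    False := by
  classical
  -- the antidiagonal subspace `N = ker π`, of dimension `≥ 19`, negative definite
  let π : (K3Index → ℚ) →ₗ[ℚ] (Fin 3 → ℚ) :=
    { toFun := fun v => ![v (Sum.inr (Sum.inl 0)) + v (Sum.inr (Sum.inl 1)),
        v (Sum.inr (Sum.inr (Sum.inl 0))) + v (Sum.inr (Sum.inr (Sum.inl 1))),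
        v (Sum.inr (Sum.inr (Sum.inr 0))) + v (Sum.inr (Sum.inr (Sum.inr 1)))]
      map_add' := fun v w => by
        funext k
        fin_cases k <;> simp <;> ring
      map_smul' := fun r v => by
        funext k
        fin_cases k <;> simp <;> ring }
  have hNmem : ∀ v ∈ LinearMap.ker π, v (Sum.inr (Sum.inl 1)) = -v (Sum.inr (Sum.inl 0)) ∧
      v (Sum.inr (Sum.inr (Sum.inl 1))) = -v (Sum.inr (Sum.inr (Sum.inl 0))) ∧
      v (Sum.inr (Sum.inr (Sum.inr 1))) = -v (Sum.inr (Sum.inr (Sum.inr 0))) := fun v hv => by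
    have h := LinearMap.mem_ker.1 hv
    have h0 := congrFun h 0
    have h1 := congrFun h 1
    have h2 := congrFun h 2
    simp [π] at h0 h1 h2
    exact ⟨by linarith, by linarith, by linarith⟩
  have hNneg : ∀ v ∈ LinearMap.ker π, v ≠ 0 → k3FormRat v v < 0 := fun v hv hv0 =>
    k3FormRat_self_neg_of_antidiag (hNmem v hv).1 (hNmem v hv).2.1 (hNmem v hv).2.2 hv0
  have hN : 19 ≤ Module.finrank ℚ (LinearMap.ker π) := by
    have h := LinearMap.finrank_range_add_finrank_ker π
    have hr : Module.finrank ℚ (LinearMap.range π) ≤ 3 := by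
      calc Module.finrank ℚ (LinearMap.range π) ≤ Module.finrank ℚ (Fin 3 → ℚ) := Submodule.finrank_le _
        _ = 3 := by rw [Module.finrank_fintype_fun_eq_card]; rfl
    rw [finrank_k3Rat] at h
    omega
  -- the positive definite subspace `P = span u`, of dimension `4`
  let L : (Fin 4 → ℚ) →ₗ[ℚ] (K3Index → ℚ) := Fintype.linearCombination ℚ u
  have hpair : ∀ (c : Fin 4 → ℚ) (j : Fin 4), k3FormRat (L c) (u j) = c j * k3FormRat (u j) (u j) := by
    intro c j
    simp only [L, Fintype.linearCombination_apply, map_sum, map_smul, LinearMap.sum_apply,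
      LinearMap.smul_apply, smul_eq_mul]
    rw [Finset.sum_eq_single j (fun i _ hij => by rw [horth i j hij, mul_zero])
      (fun h => absurd (Finset.mem_univ j) h)]
  have hsq : ∀ c : Fin 4 → ℚ, k3FormRat (L c) (L c) = ∑ j, c j * c j * k3FormRat (u j) (u j) := by
    intro c
    calc k3FormRat (L c) (L c) = k3FormRat (L c) (∑ j, c j • u j) := by
          congr 1
      _ = ∑ j, c j * k3FormRat (L c) (u j) := by
          rw [map_sum]
          simp only [map_smul, smul_eq_mul]
      _ = ∑ j, c j * c j * k3FormRat (u j) (u j) :=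
          Finset.sum_congr rfl fun j _ => by rw [hpair]; ring
  have hLinj : Function.Injective L := by
    rw [← LinearMap.ker_eq_bot, Submodule.eq_bot_iff]
    intro c hc
    rw [LinearMap.mem_ker] at hc
    funext j
    have h := hpair c j
    rw [hc, map_zero, LinearMap.zero_apply] at h
    rcases mul_eq_zero.1 h.symm with h | h
    · exact h
    · exact absurd h (hpos j).ne'
  have hP : Module.finrank ℚ (LinearMap.range L) = 4 := by
    rw [LinearMap.finrank_range_of_inj hLinj, Module.finrank_fintype_fun_eq_card]
    rfl
  have hPpos : ∀ x ∈ LinearMap.range L, x ≠ 0 → 0 < k3FormRat x x := by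
    intro x hx hx0
    obtain ⟨c, rfl⟩ := LinearMap.mem_range.1 hx
    have hc0 : c ≠ 0 := fun h => hx0 (by rw [h, map_zero])
    obtain ⟨j, hj⟩ := Function.ne_iff.1 hc0
    have hj' : c j ≠ 0 := by simpa using hj
    rw [hsq]
    refine Finset.sum_pos' (fun i _ => ?_) ⟨j, Finset.mem_univ j, ?_⟩
    · have := hpos i
      nlinarith [mul_self_nonneg (c i)]
    · have := hpos j
      have hcj : 0 < c j * c j := mul_self_pos.2 hj'
      nlinarith
  -- `P ⊓ N = ⊥` and the dimension count `4 + 19 ≤ 22`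
  have hinf : LinearMap.range L ⊓ LinearMap.ker π = ⊥ := by
    rw [Submodule.eq_bot_iff]
    intro w hw
    by_contra hw0
    have hp := hPpos w hw.1 hw0
    have hn := hNneg w hw.2 hw0
    linarith
  have hsum := Submodule.finrank_sup_add_finrank_inf_eq (LinearMap.range L) (LinearMap.ker π)
  rw [hinf, finrank_bot, hP] at hsum
  have hle : Module.finrank ℚ ↥(LinearMap.range L ⊔ LinearMap.ker π) ≤ Module.finrank ℚ (K3Index → ℚ) :=
    Submodule.finrank_le _
  rw [finrank_k3Rat] at hle
  omega

/-! ### From Varesco's `T(S)_ℚ ≅ U_ℚ² ⊕ ⟨a⟩ ⊕ ⟨b⟩` to the lattice hypothesis, and the sector by name -/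
set_option maxHeartbeats 400000 in
/-- **Bridge from `HasTranscendentalLatticeU2ab`**: for a projective K3 surface `S` with
`T(S)_ℚ ≅ U_ℚ² ⊕ ⟨a⟩ ⊕ ⟨b⟩` (`a, b < 0`; the tree's sign-free predicate
`HasTranscendentalLatticeU2ab S a b` of the Varesco 2025 record) and any marking `(η, p')` (clauses of
`Huybrechts_K3_marking_exists`), the marking coordinates `v₀, …, v₅ ∈ ℚ²²` of the six rational basis
classes `tᵢ` of `T(S) ⊗ ℂ` have K3-form Gram matrix `picardSixteenGram a b` and span the transcendental
coordinate vectors. Two points: (i) rational classes have rational coordinates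
(`isRationalClass_iff_of_marking`), and a rational class in the `ℂ`-span of the `tᵢ` is a RATIONAL
combination (`exists_rat_coords_of_isRationalClass_of_linearIndependent`); (ii) the generator `p` of
`H⁴` in the predicate equals the marking's `p'` — they agree up to sign (`eq_or_eq_neg_of_zsmul`), and
`p = −p'` would give the `vᵢ` the Gram matrix `−G(a,b)`, exhibiting the four pairwise orthogonal
positive vectors `v₀ − v₁, v₂ − v₃, v₄, v₅` in `Λ_ℚ`, impossible by `not_four_orthogonal_pos`
(signature `(3,19)`; this is where `a, b < 0` enters). [cite: Varesco2025, Thm. 4.3 (§4)]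
[cite: Huybrechts2016K3, Ch. 1 Prop. 3.5 and Ch. 14 §0.3 (vi)] -/
theorem exists_coords_of_hasTranscendentalLatticeU2ab (hS : IsK3Surface S)
    (η : complexBetti S (2 * 1) ≃ₗ[ℂ] (K3Index → ℂ)) (p' : complexBetti S (2 * 2)) (hp' : p' ≠ 0)
    (hpi' : IsIntegralClass p')
    (hgen' : ∀ q : complexBetti S (2 * 2), IsIntegralClass q → ∃ n : ℤ, q = n • p')
    (hint' : ∀ c : complexBetti S (2 * 1), IsIntegralClass c ↔ ∃ v : K3Index → ℤ, η c = fun i => (v i : ℂ))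
    (hcup' : ∀ a b : complexBetti S (2 * 1),
      cupProduct (rfl : 2 * 1 + 2 * 1 = 2 * 2) a b = k3Form (η a) (η b) • p')
    {a b : ℤ} (ha : a < 0) (hb : b < 0) (hT : HasTranscendentalLatticeU2ab S a b) :
    ∃ v : Fin 6 → (K3Index → ℚ),
      (∀ w : K3Index → ℚ, IsTranscendentalCoord S η w → w ∈ Submodule.span ℚ (Set.range v)) ∧
      ∀ i j, k3FormRat (v i) (v j) = (picardSixteenGram a b i j : ℚ) := by
  classical
  obtain ⟨p, t, hpint, hpgen, htT, hli, hspanT, hGram⟩ := hT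
  have hcoord : ∀ i, ∃ w : K3Index → ℚ, η (t i) = fun k => (w k : ℂ) :=
    fun i => (isRationalClass_iff_of_marking hS η hint' (t i)).1 (htT i).2
  choose v hv using hcoord
  have hcupij : ∀ i j,
      ((k3FormRat (v i) (v j) : ℚ) : ℂ) • p' = ((picardSixteenGram a b i j : ℤ) : ℂ) • p := by
    intro i j
    rw [← k3Form_ratCast, ← hv i, ← hv j, ← hcup', hGram]
  have hpm : p = p' ∨ p = -p' := eq_or_eq_neg_of_zsmul hp' (hpgen p' hpi') (hgen' p hpint)
  refine ⟨v, fun w hw => ?_, ?_⟩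
  · -- rational transcendental vectors are rational combinations of the `vᵢ`
    have hxT : η.symm (fun k => (w k : ℂ)) ∈ Submodule.span ℂ (Set.range t) := by
      rw [hspanT]; exact hw
    have hxrat : IsRationalClass (η.symm (fun k => (w k : ℂ))) :=
      (isRationalClass_iff_of_marking hS η hint' _).2 ⟨w, η.apply_symm_apply _⟩
    obtain ⟨r, hr⟩ :=
      exists_rat_coords_of_isRationalClass_of_linearIndependent (fun i => (htT i).2) hli hxrat hxT
    have hw' : w = ∑ i, r i • v i := by
      have h := congrArg η hr
      rw [η.apply_symm_apply, map_sum] at h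
      funext k
      have hk := congrFun h k
      simp only [map_smul, hv, Finset.sum_apply, Pi.smul_apply, smul_eq_mul] at hk
      have hk' : ((w k : ℚ) : ℂ) = ((∑ i, r i * v i k : ℚ) : ℂ) := by rw [hk]; push_cast; rfl
      have hk'' : w k = ∑ i, r i * v i k := by exact_mod_cast hk'
      rw [hk'']
      simp only [Finset.sum_apply, Pi.smul_apply, smul_eq_mul]
    rw [hw']
    exact Submodule.sum_mem _ fun i _ =>
      Submodule.smul_mem _ _ (Submodule.subset_span (Set.mem_range_self i))
  · rcases hpm with hpp | hpp
    · intro i j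
      have h := hcupij i j
      rw [hpp] at h
      have h' := smul_left_injective ℂ hp' h
      exact_mod_cast h'
    · exfalso
      have hneg : ∀ i j, k3FormRat (v i) (v j) = -(picardSixteenGram a b i j : ℚ) := by
        intro i j
        have h := hcupij i j
        rw [hpp, smul_neg, ← neg_smul] at h
        have h' := smul_left_injective ℂ hp' h
        exact_mod_cast h'
      have haQ : (0 : ℚ) < -(a : ℚ) := by
        have h : (a : ℚ) < 0 := by exact_mod_cast ha
        linarith
      have hbQ : (0 : ℚ) < -(b : ℚ) := by
        have h : (b : ℚ) < 0 := by exact_mod_cast hb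
        linarith
      refine not_four_orthogonal_pos ![v 0 - v 1, v 2 - v 3, v 4, v 5] (fun i => ?_) (fun i j hij => ?_)
      · fin_cases i <;>
          simp [map_sub, LinearMap.sub_apply, hneg, picardSixteenGram, haQ, hbQ]
      · fin_cases i <;> fin_cases j <;>
          simp_all [map_sub, LinearMap.sub_apply, picardSixteenGram]

/-- **HC for all powers `Sᵏ` of every projective K3 surface with `T(S)_ℚ ≅ U_ℚ² ⊕ ⟨a⟩ ⊕ ⟨b⟩`
(`a, b < 0`), modulo Floccari 2026 Thm. 5.11 (ii) and the existence of markings** — the conclusion of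
Varesco 2025 Thm. 0.2 for the individual surface, with NO family and NO Kuga–Satake hypothesis
(Floccari's theorem supplies the Kuga–Satake algebraicity through the `Kumⁿ` route).
[cite: Floccari2026, Thm. 5.11 (§5)] [cite: Varesco2025, Thm. 0.2 = Thm. 4.3 (§4)]
[cite: Huybrechts2016K3, Ch. 1 Prop. 3.5] -/
theorem hodgeConjectureFor_powers_of_hasTranscendentalLatticeU2ab
    (hF : Floccari2026_hodgeClasses_algebraic_powers_of_K3_of_transcendental_embedding)
    (hmark : Huybrechts_K3_marking_exists) (hS : IsK3Surface S) {a b : ℤ} (ha : a < 0) (hb : b < 0)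
    (hT : HasTranscendentalLatticeU2ab S a b) (k : ℕ) :
    HodgeConjectureFor (k * 2) (S.pow k) := by
  obtain ⟨η, p, x, hp, ⟨hpi, hgen, hint, hcup, -, -⟩, -⟩ := hmark S hS
  obtain ⟨v, hspan, hG⟩ :=
    exists_coords_of_hasTranscendentalLatticeU2ab hS η p hp hpi hgen hint hcup ha hb hT
  exact hodgeConjectureFor_powers_of_transcendental_le_U2ab hF hS η p hp hpi hgen hint hcup ha.ne hb v
    hspan hG k

/-- **HC for `S ⊗ S` for every projective K3 surface with `T(S)_ℚ ≅ U_ℚ² ⊕ ⟨a⟩ ⊕ ⟨b⟩**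
(`a, b < 0`; Picard number `16`, Witt index two), modulo Floccari 2026 Thm. 5.11 (ii) and markings:
the KNOWN SECTOR of the crux `PicardThreeK3Squares` at `ρ(S) = 16` by name. The printed instances
(Varesco Examples 4.4–4.5: six-line double planes `T ≅ U_ℚ² ⊕ ⟨−2⟩²`, 15-nodal quartics
`T ≅ U_ℚ² ⊕ ⟨−6⟩ ⊕ ⟨−2⟩`) are covered as soon as they are constructed with this predicate.
[cite: Floccari2026, Thm. 5.11 (§5)] [cite: Varesco2025, Thm. 0.2 = Thm. 4.3 and Examples 4.4–4.5 (§4)]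
[cite: Schlickewei2010, Introduction] -/
theorem hodgeConjectureFor_square_of_hasTranscendentalLatticeU2ab
    (hF : Floccari2026_hodgeClasses_algebraic_powers_of_K3_of_transcendental_embedding)
    (hmark : Huybrechts_K3_marking_exists) (hS : IsK3Surface S) {a b : ℤ} (ha : a < 0) (hb : b < 0)
    (hT : HasTranscendentalLatticeU2ab S a b) : HodgeConjectureFor 4 (S ⊗ S) :=
  hodgeConjectureFor_tensor_self_of_pow_two hS.isSmoothProjective
    (hodgeConjectureFor_powers_of_hasTranscendentalLatticeU2ab hF hmark hS ha hb hT 2)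

/-! ### Necessity: a Floccari embedding of a `6`-dimensional lattice forces Witt index two -/

/-- **Necessity of Witt index two.** If a `6`-dimensional subspace `W ⊆ Λ_ℚ` embeds isometrically
(for the K3 form) into `(U³ ⊕ ⟨-m⟩) ⊗ ℚ` — the hypothesis of Floccari's Thm. 5.11 read on `W` — then
`W` contains two linearly independent vectors spanning a TOTALLY ISOTROPIC plane: the image of `W`
(dimension `6`) meets the isotropic `3`-space `⟨e₁, e₂, e₃⟩` of `U³` in dimension `≥ 6 + 3 − 7 = 2`.
With `hodgeConjectureFor_powers_of_transcendental_le_U2ab` (sufficiency) this identifies Floccari's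
sector among the K3 surfaces of Picard number `16` as exactly those whose `T(S)_ℚ` has Witt index two
(`≅ U_ℚ² ⊕ ⟨a⟩ ⊕ ⟨b⟩`, Varesco's lattices); the residue of the crux at `ρ = 16` is Witt index one.
[cite: Floccari2026, Thm. 5.11 (§5)] [cite: Varesco2025, Thm. 4.3 (§4)] -/
theorem exists_isotropic_pair_of_embedding (m : ℕ) (W : Submodule ℚ (K3Index → ℚ))
    (hW : Module.finrank ℚ W = 6) (ι : (K3Index → ℚ) →ₗ[ℚ] (U3mIndex → ℚ))
    (hiso : ∀ v ∈ W, ∀ w ∈ W, u3mFormQ m (ι v) (ι w) = k3FormRat v w)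
    (hinj : ∀ v ∈ W, ι v = 0 → v = 0) :
    ∃ x ∈ W, ∃ y ∈ W, LinearIndependent ℚ ![x, y] ∧
      k3FormRat x x = 0 ∧ k3FormRat x y = 0 ∧ k3FormRat y y = 0 := by
  classical
  -- the isotropic `3`-space `I₃ = ⟨e₁, e₂, e₃⟩` of `U ⊕ U ⊕ U`
  let e : Fin 3 → (U3mIndex → ℚ) :=
    ![Pi.single (Sum.inl (Sum.inl 0)) 1, Pi.single (Sum.inl (Sum.inr (Sum.inl 0))) 1,
      Pi.single (Sum.inl (Sum.inr (Sum.inr 0))) 1]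
  have he0 : ∀ i j, u3mFormQ m (e i) (e j) = 0 := by
    intro i j
    rw [u3mFormQ_eq_toBilin']
    fin_cases i <;> fin_cases j <;> simp [e, u3mGram, hyperbolicPlaneGram, Matrix.map_apply]
  have hli : LinearIndependent ℚ e := by
    rw [Fintype.linearIndependent_iff]
    intro g hg i
    fin_cases i
    · simpa [e, Fin.sum_univ_three, Pi.single_apply] using congrFun hg (Sum.inl (Sum.inl 0))
    · simpa [e, Fin.sum_univ_three, Pi.single_apply] using congrFun hg (Sum.inl (Sum.inr (Sum.inl 0)))
    · simpa [e, Fin.sum_univ_three, Pi.single_apply] using congrFun hg (Sum.inl (Sum.inr (Sum.inr 0)))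
  let I₃ : Submodule ℚ (U3mIndex → ℚ) := Submodule.span ℚ (Set.range e)
  have hI₃ : Module.finrank ℚ I₃ = 3 := by
    rw [finrank_span_eq_card hli, Fintype.card_fin]
  have hI₃iso : ∀ x ∈ I₃, ∀ y ∈ I₃, u3mFormQ m x y = 0 := by
    intro x hx y hy
    obtain ⟨c, rfl⟩ := (Submodule.mem_span_range_iff_exists_fun ℚ).1 hx
    obtain ⟨d, rfl⟩ := (Submodule.mem_span_range_iff_exists_fun ℚ).1 hy
    rw [u3mFormQ_eq_toBilin']
    simp only [map_sum, map_smul, LinearMap.sum_apply, LinearMap.smul_apply, smul_eq_mul,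
      ← u3mFormQ_eq_toBilin', he0, mul_zero, Finset.sum_const_zero]
  -- `ι(W)` has dimension `6`
  let g : W →ₗ[ℚ] (U3mIndex → ℚ) := ι.domRestrict W
  have hker : LinearMap.ker g = ⊥ := by
    rw [Submodule.eq_bot_iff]
    intro w hw
    rw [LinearMap.mem_ker, LinearMap.domRestrict_apply] at hw
    exact Subtype.ext (hinj w w.2 hw)
  have hrange : Module.finrank ℚ (LinearMap.range g) = 6 := by
    have h := LinearMap.finrank_range_add_finrank_ker g
    rw [hker, finrank_bot, hW] at h
    omega
  -- `ι(W) ∩ I₃` has dimension `≥ 2`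
  have h7 : Module.finrank ℚ (U3mIndex → ℚ) = 7 := by rw [Module.finrank_fintype_fun_eq_card]; rfl
  have hJ : 1 < Module.finrank ℚ ↥(LinearMap.range g ⊓ I₃) := by
    have hsum := Submodule.finrank_sup_add_finrank_inf_eq (LinearMap.range g) I₃
    have hle : Module.finrank ℚ ↥(LinearMap.range g ⊔ I₃) ≤ Module.finrank ℚ (U3mIndex → ℚ) :=
      Submodule.finrank_le _
    rw [hrange, hI₃] at hsum
    rw [h7] at hle
    omega
  obtain ⟨j₁, hj₁0⟩ := Module.finrank_pos_iff_exists_ne_zero.1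
    (by omega : 0 < Module.finrank ℚ ↥(LinearMap.range g ⊓ I₃))
  obtain ⟨j₂, hj⟩ := exists_linearIndependent_pair_of_one_lt_finrank hJ hj₁0
  obtain ⟨w₁, hw₁⟩ := LinearMap.mem_range.1 j₁.2.1
  obtain ⟨w₂, hw₂⟩ := LinearMap.mem_range.1 j₂.2.1
  have hgw₁ : ι (w₁ : K3Index → ℚ) = (j₁ : U3mIndex → ℚ) := by
    rw [← hw₁, LinearMap.domRestrict_apply]
  have hgw₂ : ι (w₂ : K3Index → ℚ) = (j₂ : U3mIndex → ℚ) := by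
    rw [← hw₂, LinearMap.domRestrict_apply]
  refine ⟨w₁, w₁.2, w₂, w₂.2, ?_, ?_, ?_, ?_⟩
  · -- independence pulls back along `ι`
    have hj' : LinearIndependent ℚ ![(j₁ : U3mIndex → ℚ), (j₂ : U3mIndex → ℚ)] := by
      have h := hj.map' (Submodule.subtype _) (Submodule.ker_subtype _)
      have hfun : (⇑(LinearMap.range g ⊓ I₃).subtype ∘ ![j₁, j₂]) =
          ![(j₁ : U3mIndex → ℚ), (j₂ : U3mIndex → ℚ)] := by
        funext i
        fin_cases i <;> rfl
      rw [hfun] at h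
      exact h
    apply LinearIndependent.of_comp ι
    have hfun2 : (⇑ι ∘ ![(w₁ : K3Index → ℚ), (w₂ : K3Index → ℚ)]) =
        ![(j₁ : U3mIndex → ℚ), (j₂ : U3mIndex → ℚ)] := by
      funext i
      fin_cases i
      · simpa using hgw₁
      · simpa using hgw₂
    rw [hfun2]
    exact hj'
  · rw [← hiso _ w₁.2 _ w₁.2, hgw₁]
    exact hI₃iso _ j₁.2.2 _ j₁.2.2
  · rw [← hiso _ w₁.2 _ w₂.2, hgw₁, hgw₂]
    exact hI₃iso _ j₁.2.2 _ j₂.2.2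
  · rw [← hiso _ w₂.2 _ w₂.2, hgw₂]
    exact hI₃iso _ j₂.2.2 _ j₂.2.2

end Summit.HodgeConjecture.HodgeConjecture.Theorems.MarkmanPartnerTransport.KugaSatakeSector

end
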